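import Summits.HodgeConjecture.HodgeConjecture.Theses.PadicSemiregularLift
import Summits.HodgeConjecture.HodgeConjecture.Theorems.FormalLiftingFromClassLifting.Negative.ProClassCorrectionStubs

/-!
# `FormalVectorBundlesAlgebraize` (stmt-HodgeConjecture-14106) · Negative · perfectness and the level-one form

Support lemmas of the standing disprover of crux P3a of route `PadicSemiregularLift`
(refuter-cdisprove-stmt-HodgeConjecture-14106-g2-0, cycle 2, 2026-08-16; work file
`Cruxes/FormalVectorBundlesAlgebraize/Disproof.lean` §§5–6). The crux (`IsSmoothProperModel d 𝒳 →
LiftsFormally 𝒳 E₁ → LiftsTo 𝒳 E₁`) is Grothendieck's existence theorem for vector bundles and resists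
disproof; what is kernel-checked here is WHERE PERFECTNESS OF `k` ENTERS THE TYPED STATEMENT and the
resulting LEVEL-ONE REFORMULATION:

* for `k` perfect the residue map `W(k)/p → k` is bijective, so the comparison map `X_k ⟶ X_1` of the
  `p`-adic tower (`WittScheme.specialFibreToThickening 𝒳 0`) is an ISOMORPHISM for every `W(k)`-scheme
  `𝒳` — this is REUSED from the sibling crux's negative file
  (`FormalLiftingFromClassLifting.Negative.isIso_specialFibreToThickening_zero'`, imported, not re-proved);
* `not_injective_wittQuotToResidue_ratFunc` — for the IMPERFECT field `𝔽_p(t)` it is not: `V[t]` dies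
  in `k` but is not a multiple of `p` (`t` is not a `p`-th power; `RatFunc.intDegree`), so without
  `[PerfectRing k p]` the map `X_k ⟶ X_1` would be a genuine nilpotent thickening;
* `nonempty_iso_of_pullback_iso` — modules with isomorphic pull-backs along an isomorphism are isomorphic;
  `liftsTo_congr`, `liftsFormally_congr`, `liftsToThickening_congr` — the tree's lifting predicates are
  invariant under isomorphism of `E₁`;
* `liftsTo_pullback_iff_levelOne` — for a module `E0` on `X_1`, `LiftsTo 𝒳 (E0|_{X_k})` iff some vector
  bundle `F` on `𝒳` has `F|_{X_1} ≅ E0`; hence `crux_iff_levelOne`: the crux is EQUIVALENT to "every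
  formal vector bundle `(E n)` on a smooth proper model admits an algebraic vector bundle with the same
  FIRST level" — a disproof must produce a tower whose first level is not algebraic, while nothing is
  claimed about the higher levels (which `E₁` does not determine).

No statement here asserts a Theses decl (the last one is an `↔` reformulation of the crux).

References: U. Görtz, T. Wedhorn, *Algebraic Geometry II* (2023), Thm 24.94, Prop 24.95; J.-P. Serre,
*Local Fields*, II §6 (`W(k)` for perfect `k`); Mathlib `RingTheory/WittVector/Complete`.
-/

-- `Summit.HodgeConjecture.HodgeConjecture.…` is the prescribed namespace of a single-conjunct summit (D-0017).
set_option linter.dupNamespace false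

namespace Summit.HodgeConjecture.HodgeConjecture.Theorems.FormalVectorBundlesAlgebraize.Negative

open CategoryTheory AlgebraicGeometry Limits
open Literature.AlgebraicGeometry.Motives Literature.AlgebraicGeometry.Motives.WittScheme
open Summit.HodgeConjecture.HodgeConjecture.Theses.PadicSemiregularLift (FormalVectorBundlesAlgebraize)
open Summit.HodgeConjecture.HodgeConjecture.Theorems.FormalLiftingFromClassLifting.Negative
  (isIso_specialFibreToThickening_zero')

noncomputable section

universe u



/-- **Perfectness is used**: for the imperfect field `k = 𝔽_p(t)` the residue map `W(k)/p → k` is NOT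
injective — `V[t]` (Verschiebung of the Teichmüller lift of `t`) maps to `0` in `k` but is not a
multiple of `p`: `z · p` has first Witt component `z₀^p` (Mathlib `WittVector.mul_charP_coeff_succ`),
`V[t]` has first component `t`, and `t` is not a `p`-th power in `𝔽_p(t)` (`RatFunc.intDegree_X = 1`
is not divisible by `p`). [folklore] -/
theorem not_injective_wittQuotToResidue_ratFunc (p : ℕ) [Fact p.Prime] :
    ¬ Function.Injective (wittQuotToResidue p (RatFunc (ZMod p)) 0) := by
  intro hinj
  set x : WittVector p (RatFunc (ZMod p)) :=
    WittVector.verschiebung (WittVector.teichmuller p RatFunc.X) with hx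
  have hx0 : wittQuotToResidue p (RatFunc (ZMod p)) 0 (Ideal.Quotient.mk _ x) = 0 := by
    change WittVector.constantCoeff x = 0
    rw [WittVector.constantCoeff_apply, hx, WittVector.verschiebung_coeff_zero]
  have hmem : x ∈ Ideal.span {(p : WittVector p (RatFunc (ZMod p)))} ^ (0 + 1) := by
    rw [← Ideal.Quotient.eq_zero_iff_mem]
    exact hinj (hx0.trans (map_zero _).symm)
  rw [zero_add, pow_one, Ideal.mem_span_singleton'] at hmem
  obtain ⟨z, hz⟩ := hmem
  have h1 : (z * p).coeff 1 = x.coeff 1 := by rw [hz]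
  rw [WittVector.mul_charP_coeff_succ, hx, WittVector.verschiebung_coeff_add_one,
    WittVector.teichmuller_coeff_zero] at h1
  have hz0 : z.coeff 0 ≠ 0 := by
    intro h
    rw [h, zero_pow (Fact.out : p.Prime).ne_zero] at h1
    exact RatFunc.X_ne_zero h1.symm
  have hdeg : ∀ n : ℕ, RatFunc.intDegree (z.coeff 0 ^ n) = n * RatFunc.intDegree (z.coeff 0) := by
    intro n
    induction n with
    | zero => simp
    | succ n ih =>
      rw [pow_succ, RatFunc.intDegree_mul (pow_ne_zero _ hz0) hz0, ih]
      push_cast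
      ring
  have := hdeg p
  rw [h1, RatFunc.intDegree_X] at this
  have hp : (1 : ℤ) < p := by exact_mod_cast (Fact.out : p.Prime).one_lt
  have hdvd : (p : ℤ) ∣ 1 := ⟨_, this⟩
  have := Int.eq_one_of_dvd_one (by positivity) hdvd
  omega

section LevelOne

/-- Modules with isomorphic pull-backs along an ISOMORPHISM of schemes are isomorphic (pull back further
along the inverse; Mathlib `Scheme.Modules.pullbackComp`, `pullbackId`). [folklore] -/
theorem nonempty_iso_of_pullback_iso {A B : Scheme.{u}} (φ : A ⟶ B) [IsIso φ] {M N : B.Modules}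
    (e : (Scheme.Modules.pullback φ).obj M ≅ (Scheme.Modules.pullback φ).obj N) : Nonempty (M ≅ N) :=
  ⟨((Scheme.Modules.pullbackId B).app M).symm ≪≫
    (Scheme.Modules.pullbackCongr (IsIso.inv_hom_id φ).symm).app M ≪≫
    ((Scheme.Modules.pullbackComp (inv φ) φ).app M).symm ≪≫
    (Scheme.Modules.pullback (inv φ)).mapIso e ≪≫
    (Scheme.Modules.pullbackComp (inv φ) φ).app N ≪≫
    (Scheme.Modules.pullbackCongr (IsIso.inv_hom_id φ)).app N ≪≫
    (Scheme.Modules.pullbackId B).app N⟩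

variable {p : ℕ} [Fact p.Prime] {k : Type} [Field k] [CharP k p] [PerfectRing k p]

/-- **Level-one form of `LiftsTo`.** For a module `E0` on the first thickening `X_1` of a `W(k)`-scheme
`𝒳` (`k` perfect), the module `E0|_{X_k}` lifts algebraically iff some vector bundle `F` on `𝒳` has
`F|_{X_1} ≅ E0` — because `X_k ⟶ X_1` is an isomorphism (`isIso_specialFibreToThickening_zero'`) and
`X_k ⟶ X_1 ⟶ 𝒳` is `X_k ⟶ 𝒳`. No hypothesis on `𝒳`. [folklore] -/
theorem liftsTo_pullback_iff_levelOne (𝒳 : SchemeOver (WittVector p k))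
    (E0 : (thickening 𝒳 1).left.Modules) :
    LiftsTo 𝒳 ((Scheme.Modules.pullback (specialFibreToThickening 𝒳 0)).obj E0) ↔
      ∃ F : 𝒳.left.Modules, IsVectorBundle F ∧
        Nonempty ((Scheme.Modules.pullback (thickeningι 𝒳 1)).obj F ≅ E0) := by
  constructor
  · rintro ⟨F, hF, ⟨e⟩⟩
    haveI := isIso_specialFibreToThickening_zero' 𝒳
    exact ⟨F, hF, nonempty_iso_of_pullback_iso (specialFibreToThickening 𝒳 0)
      ((Scheme.Modules.pullbackComp (specialFibreToThickening 𝒳 0) (thickeningι 𝒳 1)).app F ≪≫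
        (Scheme.Modules.pullbackCongr (specialFibreToThickening_ι 𝒳 0)).app F ≪≫ e)⟩
  · rintro ⟨F, hF, ⟨e⟩⟩
    exact ⟨F, hF, ⟨(Scheme.Modules.pullbackCongr (specialFibreToThickening_ι 𝒳 0).symm).app F ≪≫
      (Scheme.Modules.pullbackComp (specialFibreToThickening 𝒳 0) (thickeningι 𝒳 1)).symm.app F ≪≫
      (Scheme.Modules.pullback (specialFibreToThickening 𝒳 0)).mapIso e⟩⟩

omit [Fact p.Prime] [CharP k p] [PerfectRing k p] in
/-- `LiftsTo` is invariant under isomorphism of the module on the special fibre. [folklore] -/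
theorem liftsTo_congr [Fact p.Prime] (𝒳 : SchemeOver (WittVector p k))
    {E₁ E₁' : (specialFibre 𝒳).left.Modules} (i : E₁ ≅ E₁') : LiftsTo 𝒳 E₁ ↔ LiftsTo 𝒳 E₁' :=
  ⟨fun ⟨F, hF, ⟨e⟩⟩ => ⟨F, hF, ⟨e ≪≫ i⟩⟩, fun ⟨F, hF, ⟨e⟩⟩ => ⟨F, hF, ⟨e ≪≫ i.symm⟩⟩⟩

omit [PerfectRing k p] in
/-- `LiftsFormally` is invariant under isomorphism of the module on the special fibre. [folklore] -/
theorem liftsFormally_congr (𝒳 : SchemeOver (WittVector p k))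
    {E₁ E₁' : (specialFibre 𝒳).left.Modules} (i : E₁ ≅ E₁') :
    LiftsFormally 𝒳 E₁ ↔ LiftsFormally 𝒳 E₁' :=
  ⟨fun ⟨E, hE, hs, ⟨e⟩⟩ => ⟨E, hE, hs, ⟨e ≪≫ i⟩⟩, fun ⟨E, hE, hs, ⟨e⟩⟩ => ⟨E, hE, hs, ⟨e ≪≫ i.symm⟩⟩⟩

omit [PerfectRing k p] in
/-- `LiftsToThickening` is invariant under isomorphism of the module on the special fibre. [folklore] -/
theorem liftsToThickening_congr (𝒳 : SchemeOver (WittVector p k))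
    {E₁ E₁' : (specialFibre 𝒳).left.Modules} (i : E₁ ≅ E₁') (n : ℕ) :
    LiftsToThickening 𝒳 E₁ n ↔ LiftsToThickening 𝒳 E₁' n :=
  ⟨fun ⟨E, hE, ⟨e⟩⟩ => ⟨E, hE, ⟨e ≪≫ i⟩⟩, fun ⟨E, hE, ⟨e⟩⟩ => ⟨E, hE, ⟨e ≪≫ i.symm⟩⟩⟩

/-- **Level-one form of the crux** (`↔`, no positive assertion): `FormalVectorBundlesAlgebraize` is
equivalent to "on every smooth proper model, every formal vector bundle `(E n)` admits an algebraic
vector bundle `F` with `F|_{X_1} ≅ E 0`". So any disproof must exhibit a tower whose FIRST level is not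
the restriction of an algebraic vector bundle; nothing about `E n`, `n ≥ 1`, is at stake. [folklore] -/
theorem crux_iff_levelOne :
    FormalVectorBundlesAlgebraize ↔
      ∀ (p : ℕ) [Fact p.Prime] (k : Type) [Field k] [CharP k p] [PerfectRing k p] (d : ℕ)
        (𝒳 : SchemeOver (WittVector p k)), IsSmoothProperModel d 𝒳 →
        ∀ (E : ∀ n : ℕ, (thickening 𝒳 (n + 1)).left.Modules),
          (∀ n, IsVectorBundle (E n)) →
          (∀ n, Nonempty ((Scheme.Modules.pullback
            (thickeningMap 𝒳 (Nat.le_succ (n + 1)))).obj (E (n + 1)) ≅ E n)) →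
          ∃ F : 𝒳.left.Modules, IsVectorBundle F ∧
            Nonempty ((Scheme.Modules.pullback (thickeningι 𝒳 1)).obj F ≅ E 0) := by
  constructor
  · intro H p _ k _ _ _ d 𝒳 h𝒳 E hE hstep
    exact (liftsTo_pullback_iff_levelOne 𝒳 (E 0)).mp (H p k d 𝒳 h𝒳 _ ⟨E, hE, hstep, ⟨Iso.refl _⟩⟩)
  · intro H p _ k _ _ _ d 𝒳 h𝒳 E₁ hE
    obtain ⟨E, hEvb, hstep, ⟨e0⟩⟩ := hE
    exact (liftsTo_congr 𝒳 e0).mp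
      ((liftsTo_pullback_iff_levelOne 𝒳 (E 0)).mpr (H p k d 𝒳 h𝒳 E hEvb hstep))

end LevelOne

end

end Summit.HodgeConjecture.HodgeConjecture.Theorems.FormalVectorBundlesAlgebraize.Negative
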